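import Literature.AlgebraicGeometry.Frobenioids.PadicFrobenioidPairIsoColimits
import Literature.AlgebraicGeometry.Frobenioids.PadicFieldwiseSaturatedGaloisBase
import Literature.NumberTheory.GaloisRepresentations.LocalFieldGaloisSecondCountable
import HarnessLib

/-!
# Frobenioids II, Thm. 2.4 (ii): the printed pair FIRES at the Galois base `𝓑(G_{ℚ_p})⁰` — no residual inputs

Mochizuki, *The geometry of Frobenioids II*, Kyushu J. Math. **62** (2008) 401–460, §2, Theorem 2.4 (ii), author's
text p. 20 l.−5 – p. 21 l. 6 [cite: MochizukiFrdII2008, Thm 2.4 (ii) p.21]: "`Ψ` induces a pair of compatible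
isomorphisms `G₁ ⥲ G₂`; `K̄₁^× ⥲ K̄₂^×` — where this pair is well-defined up to composition with automorphisms of the
pair `(G₂, K̄₂^×)` induced by elements of `G₂`."

PROOF-ONLY (cell abc-iut, `plan/L1/SUBDAG-FrdII-Thm24.md` row W12-L17; closes audit note K-2 of abc-iut-w5-d229 on
p422264).  The one variable left in the kernel non-vacuity witness of abc-iut-w5-d194's `exists_pairIso` was a cofinal
decreasing sequence of open normal subgroups of `G_{ℚ_p}` — i.e. "`G_{ℚ_p}` is Galois-countable".  The tree now
proves this (`Padic.secondCountableTopology_absoluteGaloisGroup`, via Krasner: a `p`-adic field has countably many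
finite subextensions).  Hence, over the GALOIS BASE `CosetCat (GalFbar ℚ_[p])` (small model of `𝓑(G_{ℚ_p})⁰ = D₀`):

* `QuasiTemperoid.secondCountableTopology_galFbar_padic`, `BaseGaloisSystem.exists_antitone_cofinal_seq_galFbar_padic`
  — `G_{ℚ_p}` is Galois-countable; the universal pro-covering `(G_{ℚ_p}/N_k)_k` of `D₀` exists;
* `BaseGaloisSystem.nonempty_mulEquiv_of_cosetCat_equivalence_galFbar_padic` — an equivalence
  `𝓑(G_{ℚ_p})⁰ ≌ 𝓑^temp(Π₂)⁰` (small models) forces `G_{ℚ_p} ≃* Π₂`, no countability binder;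
* `BaseGaloisSystem.exists_pairIso_galFbar_padic` — **the printed compatible pair** for fieldwise saturated data
  `Φ₁` over `D₀` and `Φ₂` over any tempered small base, from `E = Ψ^Base` and the row-L02 slot `ΨB` ALONE
  (no `HasColimit`, no countability, no chosen covering);
* `BaseGaloisSystem.exists_pairIso_zero_galoisCosetBase` — **kernel instance with NO hypotheses at all**: the pair
  for `C₀|_{D₀}` (Ex. 1.1, fieldwise saturated by `isFieldwiseSaturated_zero`), `Ψ^Base = 𝟭`, `ΨB = 𝟙`.
Theorems only; no new definitions; nothing here bears on [IUTchIII] Cor. 3.12.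
-/

noncomputable section

namespace Literature.AlgebraicGeometry.Frobenioids

open CategoryTheory CategoryTheory.Limits Opposite Topology Filter
open Literature.AnabelianGeometry.SemiGraphs
open Literature.NumberTheory.GaloisRepresentations

universe u

namespace QuasiTemperoid

/-- **`G_{ℚ_p}` is Galois-countable**: `GalFbar ℚ_[p] = Gal(ℚ̄_p/ℚ_p)` (by definition Mathlib's
`Field.absoluteGaloisGroup ℚ_[p]`) is second countable. [cite: MochizukiSemiAnbd2006, Rmk 3.1.2 p.33] -/
theorem secondCountableTopology_galFbar_padic (p : ℕ) [Fact p.Prime] : SecondCountableTopology (GalFbar ℚ_[p]) :=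
  Padic.secondCountableTopology_absoluteGaloisGroup p

end QuasiTemperoid

namespace BaseGaloisSystem

open QuasiTemperoid

variable (p : ℕ) [Fact p.Prime]

/-- **The universal pro-covering of `D₀ = 𝓑(G_{ℚ_p})⁰`**: a cofinal antitone sequence of open normal subgroups of
`G_{ℚ_p}` (`exists_antitone_cofinal_seq` with Galois-countability DISCHARGED). [cite: MochizukiSemiAnbd2006, Rmk 3.1.2 p.33] -/
theorem exists_antitone_cofinal_seq_galFbar_padic :
    ∃ N : ℕ → OpenNormalSubgroup (GalFbar ℚ_[p]), Antitone N ∧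
      ∀ U ∈ 𝓝 (1 : GalFbar ℚ_[p]), ∃ k, (N k : Set (GalFbar ℚ_[p])) ⊆ U :=
  haveI := secondCountableTopology_galFbar_padic p
  exists_antitone_cofinal_seq (isTempered_galFbar ℚ_[p])

variable {G₂ : Type} [Group G₂] [TopologicalSpace G₂] [IsTopologicalGroup G₂] (hG₂ : IsTempered G₂)

include hG₂ in
/-- **[FrdII] Thm. 2.4 (ii) at the Galois base, "`Ψ` induces `G₁ ⥲ G₂`"**: an equivalence of small bases
`𝓑(G_{ℚ_p})⁰ ≌ 𝓑^temp(Π₂)⁰` (`CosetCat`) forces `G_{ℚ_p} ≃* Π₂` — no countability binder.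
[cite: MochizukiFrdII2008, Thm 2.4 (ii) p.21] -/
theorem nonempty_mulEquiv_of_cosetCat_equivalence_galFbar_padic (E : CosetCat (GalFbar ℚ_[p]) ≌ CosetCat G₂) :
    Nonempty (GalFbar ℚ_[p] ≃* G₂) :=
  haveI := secondCountableTopology_galFbar_padic p
  nonempty_mulEquiv_of_cosetCat_equivalence (isTempered_galFbar ℚ_[p]) hG₂ E

variable {p₁ p₂ : ℕ} [Fact p₁.Prime] [Fact p₂.Prime]
  (d₁ : PadicFrd.Datum (CosetCat (GalFbar ℚ_[p])) p₁) (d₂ : PadicFrd.Datum (CosetCat G₂) p₂)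

include hG₂ in
/-- **[FrdII] Thm. 2.4 (ii), the compatible pair at the Galois base — from `Ψ^Base` and the L02 slot alone.**  For
fieldwise saturated `p`-adic Frobenioid data `Φ₁` over `D₀ = 𝓑(G_{ℚ_p})⁰` (small model `CosetCat (GalFbar ℚ_[p])`) and
`Φ₂` over the small base of any tempered `Π₂`, an equivalence `E = Ψ^Base` with `ΨB : B₁ ≅ E^op ⋙ B₂`: there are a
universal pro-covering `(G_{ℚ_p}/N_k)_k`, `φ : G_{ℚ_p} ≃* Π₂`, a cofinal `N₂` for `Π₂` and a `φ`-EQUIVARIANT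
`e : lim→_k K_{1,G_{ℚ_p}/N_k}^× ≅ lim→_k K_{2,Π₂/N₂,k}^×` — every `HasColimit` and countability input discharged.
[cite: MochizukiFrdII2008, Thm 2.4 (ii) p.21] -/
theorem exists_pairIso_galFbar_padic (hfs₁ : d₁.IsFieldwiseSaturated) (hfs₂ : d₂.IsFieldwiseSaturated)
    (E : CosetCat (GalFbar ℚ_[p]) ≌ CosetCat G₂) (ΨB : d₁.B ≅ E.functor.op ⋙ d₂.B) :
    haveI := hasColimitsOfShape_nat_commMonCat.{0}
    ∃ (N : ℕ → OpenNormalSubgroup (GalFbar ℚ_[p])) (hN : Antitone N)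
      (_ : ∀ U ∈ 𝓝 (1 : GalFbar ℚ_[p]), ∃ k, (N k : Set (GalFbar ℚ_[p])) ⊆ U)
      (φ : GalFbar ℚ_[p] ≃* G₂) (N₂ : ℕ → OpenNormalSubgroup G₂) (hN₂ : Antitone N₂)
      (_ : ∀ U ∈ 𝓝 (1 : G₂), ∃ k, (N₂ k : Set G₂) ⊆ U)
      (e : colimit (cosetSystem N hN ⋙ PadicFrd.bZeroOn d₁.base) ≅
        colimit (cosetSystem N₂ hN₂ ⋙ PadicFrd.bZeroOn d₂.base)),
      ∀ g : GalFbar ℚ_[p],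
        e.hom ≫ colimMap (Functor.whiskerRight (toAutCoset N₂ hN₂ (φ g)).hom (PadicFrd.bZeroOn d₂.base)) =
          colimMap (Functor.whiskerRight (toAutCoset N hN g).hom (PadicFrd.bZeroOn d₁.base)) ≫ e.hom :=
  haveI := secondCountableTopology_galFbar_padic p
  exists_pairIso_of_isFieldwiseSaturated' (isTempered_galFbar ℚ_[p]) hG₂ d₁ d₂ hfs₁ hfs₂ E ΨB

/-- **Kernel instance of the printed pair with NO hypotheses**: for the `p`-adic Frobenioid `C₀|_{D₀}` of Ex. 1.1
over the Galois base (`Datum.zero` at `CosetCat.toConnected ⋙ galoisPadicFields p`, fieldwise saturated by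
`isFieldwiseSaturated_zero`), `Ψ = 𝟭` (so `Ψ^Base = 𝟭`, `ΨB = 𝟙`): the universal pro-covering, `φ : G_{ℚ_p} ≃* G_{ℚ_p}`,
and a `φ`-equivariant `e : lim→ K^× ≅ lim→ K^×` EXIST — every displayed hypothesis of the W12-L17 capstone is jointly
satisfied in the kernel at the genuine base. [cite: MochizukiFrdII2008, Thm 2.4 (ii) p.21] -/
theorem exists_pairIso_zero_galoisCosetBase :
    haveI := hasColimitsOfShape_nat_commMonCat.{0}
    let d : PadicFrd.Datum (CosetCat (GalFbar ℚ_[p])) p :=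
      PadicFrd.Datum.zero (CosetCat.toConnected (isTempered_galFbar ℚ_[p]) ⋙ galoisPadicFields p)
        (PadicFrd.Datum.isPadicLocal_galoisCosetBase p) CosetCat.isConnected CosetCat.isTotallyEpimorphic
        (PadicFrd.Datum.isMonoprime_ordInt_galoisCosetBase p)
    ∃ (N : ℕ → OpenNormalSubgroup (GalFbar ℚ_[p])) (hN : Antitone N)
      (_ : ∀ U ∈ 𝓝 (1 : GalFbar ℚ_[p]), ∃ k, (N k : Set (GalFbar ℚ_[p])) ⊆ U)
      (φ : GalFbar ℚ_[p] ≃* GalFbar ℚ_[p]) (N₂ : ℕ → OpenNormalSubgroup (GalFbar ℚ_[p])) (hN₂ : Antitone N₂)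
      (_ : ∀ U ∈ 𝓝 (1 : GalFbar ℚ_[p]), ∃ k, (N₂ k : Set (GalFbar ℚ_[p])) ⊆ U)
      (e : colimit (cosetSystem N hN ⋙ PadicFrd.bZeroOn d.base) ≅
        colimit (cosetSystem N₂ hN₂ ⋙ PadicFrd.bZeroOn d.base)),
      ∀ g : GalFbar ℚ_[p],
        e.hom ≫ colimMap (Functor.whiskerRight (toAutCoset N₂ hN₂ (φ g)).hom (PadicFrd.bZeroOn d.base)) =
          colimMap (Functor.whiskerRight (toAutCoset N hN g).hom (PadicFrd.bZeroOn d.base)) ≫ e.hom :=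
  exists_pairIso_galFbar_padic p (isTempered_galFbar ℚ_[p]) _ _ (PadicFrd.Datum.isFieldwiseSaturated_zero _ _ _ _ _)
    (PadicFrd.Datum.isFieldwiseSaturated_zero _ _ _ _ _) CategoryTheory.Equivalence.refl (Iso.refl _)

end BaseGaloisSystem

end Literature.AlgebraicGeometry.Frobenioids

end
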